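import Summits.ResolutionOfSingularities.ResolutionOfSingularities.Theorems.EquisingularLiftEquisingularLiftNatTowerInvDefs
import Literature.AlgebraicGeometry.Morphisms.CechH1Projective
import Literature.AlgebraicGeometry.Resolution.QuasiRegularSequences
import HarnessLib

/-!
# [OURS · L1 W4.5(b) · EL♮(3)] RULED-DEFS — the instantiation `DirLift.Ruled` of res-D-pv-029's parameter `Tower.RuledDatum P`
# (…NatTowerInvDefs p552985 / p556392): the RULED-SURFACE DATUM of a tower stage in T-DIRLIFT's «root-plus-iso» currency

Crux chain w45b (cell `res-hironaka`, slot W4.5(b)), working crux **EL♮** = stmt-ResolutionOfSingularities-20038, child **EL♮(3)** =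
stmt-ResolutionOfSingularities-20148, route EquisingularLift, line `sections`; rungs TOWER₂ (`stub_elnat_coneTowerPointResolution`, (round)
clause of `hsub_reachTower₂_of_invariant`) and DIR₀₁ (`stub_elnat_ratDirZeroPointResolution`, (dir) brick). Written by res-L1-w45b-stub-2
(T-DIRLIFT) on res-L1-w45b-plan-1's NAMING 2026-08-27T19:11:35Z «RULED-DEFS», in the shape worded by res-D-pv-029 (STATUS 17:33:05Z,
«root-plus-iso») and res-L1-w45b-stub-2 (PROPOSAL 18:49:23Z, R1–R4). HONEST FRAMING: OURS — planning vocabulary of the crux chain; NOT a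
statement of H. Hironaka's manuscript or of any paper; AI-written, weaker than expert review. No `sorry`; standard axioms. One definition
(`DirLift.Ruled`) and pure-logic constructors/projections.

WHAT `DirLift.Ruled O k θ P q Y F₉ Z₉ hZ₉ F₁₀ υ' G γ E X σ jG 𝓔` RECORDS — «the exceptional surface `V(𝓔) ⊆ X` of the tower stage
`(G, γ, T, E, K)` (downstairs) / `(X, σ, jG)` (upstairs) is, up to an isomorphism over a morphism of stages, the exceptional divisor of the
blowing up of a SECTION-BORN, REGULAR, `O`-FLAT, CODIMENSION-TWO CURVE lying over (a copy of) the carrier `Z̃₉`» — precisely: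
* (R1) a ROOT: a regular, integral, locally Noetherian stage `σ₀ : X₀ ⟶ P`, an ideal sheaf `I` on `X₀` (the lifted curve), the blowing up
  `τ₀ : X₁ ⟶ X₀` along `I`, and a morphism `ρ : X ⟶ X₁` from the CURRENT stage with `σ = (ρ ≫ τ₀) ≫ σ₀`;
* (R1′) an isomorphism `e : V(𝓔) ≅ V(I·𝒪_{X₁})` OVER `ρ` — at the birth of `E` (curve step, cone round, Čech round) `ρ = 𝟙`, `e = refl`; a point
  step away from `E` and a (cone or Čech) round with centre inside `V(𝓔)` keep it (`V(St 𝓔) ≅ V(𝓔)`, res-D-pv-051 p545368) — NO re-rooting;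
* (R2) the ROOT MODEL SQUARES over `Spec θ`: `j₀ : G₀ ⟶ X₀`, `j₁ : G₁ ⟶ X₁`, the downstairs blowing up `υ₁ : G₁ ⟶ G₀` along `I·𝒪_{G₀}` with
  `j₁ ≫ τ₀ = υ₁ ≫ j₀` (T-DIRLIFT D4's `hcomm`/`hυ`), tied to the current stage by `ϱ : G ⟶ G₁` (`jG ≫ ρ = ϱ ≫ j₁`) and to the carrier stage by
  `γ₀ : G₀ ⟶ F₉` (`ϱ ≫ υ₁ ≫ γ₀ = γ ≫ υ'`);
* (R2′) SECTION-BORN: the reduced trace `I·𝒪_{G₀} = 𝓘⟨Z₀⟩` of a closed `Z₀ ⊆ G₀` whose reduced scheme maps ISOMORPHICALLY onto the reduced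
  carrier `Z̃₉` under `γ₀` (at the curve step `Z₀ = Z₉`, `δ₀ = 𝟙`; at a Čech round `δ₀` = the `DirStepSec` isomorphism of the section; at a cone
  round the centre isomorphism of res-D-pv-051 p547344);
* (R3) the root curve `V(I)`: regular, `O`-flat, its `σ₀`-image off the generic point of `Y`, with QUASI-REGULAR 2-FRAMES generating `I` at its
  points (T-DIRLIFT D3b/D4's `hdir` currency, res-D-pv-051's `exists_direction_of_section` input; codimension two);
* (R4) RATIONAL ROOT, CONDITIONAL on the downstairs certificate: `RationalCarrier (redSub F₉ Z₉ hZ₉) → Nonempty (V(I) ≅ ℙ¹_O over Spec O)`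
  (`ProjCech.PP O 1`, T-P1VB's currency …NatP1VBPackage / …NatP1VBAnyBase) — vacuous on a tower whose carrier is not certified rational, so
  the curve step owes UPSTAIRS RATIONALITY of its centre exactly when a Čech round may later be run (the one non-free input of `ruled_root`).
The binders `F₁₀`, `E` of `Tower.RuledDatum` are not used by the predicate (the exact reduced trace `𝓔·𝒪_G = 𝓘⟨E⟩` is clause (e-i) of
`Tower.Exc₂`, next to which `Ruled` lives).

CONSTRUCTORS (pure logic): `DirLift.ruled_root` (birth, `ρ = 𝟙`, `ϱ = 𝟙`) and `DirLift.ruled_comp` (transport along `π : X' ⟶ X` /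
`ϖ : G' ⟶ G` with `jG' ≫ π = ϖ ≫ jG` and an iso `V(𝓔') ≅ V(𝓔)` over `π` — res-L1-w45b-stub-4's `hRuled` shape of …NatTowerInvTwoPointCentre /
…NatTowerPtRamInvTwo and res-D-pv-029's `coneRound_old` iso-transport, for ANY new `E'`, `γ' = ϖ ≫ γ`); projection `DirLift.Ruled.sigma_eq`.

References (index only): res-D-pv-029 …NatTowerInvDefs (`Tower.RuledDatum`, `Tower.Exc₂`, `Tower.Inv₂`), …NatTowerCurveStep(Cartier),
…NatTowerConeRound (the `hRuled` stand-ins); res-L1-w45b-stub-2 T-DIRLIFT D3b p555056 / D4 p551347 / `directionRoundStep` p556868;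
res-D-pv-051 DIRDICT (a) p555912 / p558327; res-type-027 T-P1VB parts 1–13. [cite: StacksProject, Tags 0804, 0805] for blow-ups (index only).
-/

set_option linter.dupNamespace false -- mandated namespace `Summit.<Summit>.<Problem>` of this single-conjunct summit

noncomputable section

open CategoryTheory CategoryTheory.Limits AlgebraicGeometry TopologicalSpace Topology IsLocalRing
open Literature.AlgebraicGeometry.Resolution
open Literature.AlgebraicGeometry.Morphisms (ProjCech.PP ProjCech.toSpec)
open AlgebraicGeometry.Scheme.IdealSheafData

namespace Summit.ResolutionOfSingularities.ResolutionOfSingularities.Cruxes.EquisingularLiftNat.Sections.DirLift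

variable (O : Type) [CommRing O] (k : Type) [Field k] (θ : O →+* k)
  (P : Scheme.{0}) (q : P ⟶ Spec (.of O)) (Y : Set P)

/-- **The ruled-surface datum of a tower stage, T-DIRLIFT's «root-plus-iso» instantiation of `Tower.RuledDatum P`** (see the module
docstring for (R1)–(R4)): the exceptional surface `V(𝓔) ⊆ X` is isomorphic, over a morphism `ρ` to the stage `X₁ = Bl_I X₀` of a ROOT,
to the exceptional divisor `V(I·𝒪_{X₁})` of the blowing up of a section-born, regular, `O`-flat curve `V(I) ⊆ X₀` with quasi-regular
2-frames, whose reduced special fibre is a copy of the carrier `Z̃₉`, and which is a projective line over `O` whenever the carrier is certified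
rational downstairs. [OURS · L1 W4.5b · planning vocabulary of the crux chain; NOT a statement of the manuscript] -/
def Ruled : Tower.RuledDatum P :=
  fun F₉ Z₉ hZ₉ _F₁₀ υ' G γ _E X σ jG 𝓔 =>
    ∃ (X₀ : Scheme.{0}) (σ₀ : X₀ ⟶ P) (I : X₀.IdealSheafData) (X₁ : Scheme.{0}) (τ₀ : X₁ ⟶ X₀) (ρ : X ⟶ X₁)
      (G₀ : Scheme.{0}) (j₀ : G₀ ⟶ X₀) (t₀ : G₀ ⟶ Spec (.of k)) (γ₀ : G₀ ⟶ F₉)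
      (G₁ : Scheme.{0}) (j₁ : G₁ ⟶ X₁) (t₁ : G₁ ⟶ Spec (.of k)) (υ₁ : G₁ ⟶ G₀) (ϱ : G ⟶ G₁),
      -- (R1) the root stage, the blowing up of the lifted curve, the current stage over it
      IsIntegral X₀ ∧ IsLocallyNoetherian X₀ ∧ Scheme.IsRegular X₀ ∧ IsBlowup τ₀ I ∧ σ = (ρ ≫ τ₀) ≫ σ₀ ∧
      -- (R1′) the exceptional surface is the root's exceptional divisor, transported along `ρ`
      (∃ e : 𝓔.subscheme ≅ (I.comap τ₀).subscheme, e.hom ≫ (I.comap τ₀).subschemeι = 𝓔.subschemeι ≫ ρ) ∧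
      -- (R2) the root model squares and their ties to the current stage and to the carrier stage
      IsPullback j₀ t₀ (σ₀ ≫ q) (Spec.map (CommRingCat.ofHom θ)) ∧
      IsPullback j₁ t₁ ((τ₀ ≫ σ₀) ≫ q) (Spec.map (CommRingCat.ofHom θ)) ∧
      j₁ ≫ τ₀ = υ₁ ≫ j₀ ∧ IsBlowup υ₁ (I.comap j₀) ∧
      jG ≫ ρ = ϱ ≫ j₁ ∧ ϱ ≫ υ₁ ≫ γ₀ = γ ≫ υ' ∧
      -- (R2′) section-born: the reduced trace of `I` is a closed `Z₀` mapping isomorphically onto the reduced carrier under `γ₀`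
      (∃ (Z₀ : Set G₀) (hZ₀ : IsClosed Z₀), I.comap j₀ = vanishingIdeal ⟨Z₀, hZ₀⟩ ∧
        ∃ δ₀ : redSub G₀ Z₀ hZ₀ ⟶ redSub F₉ Z₉ hZ₉, δ₀ ≫ redSubι F₉ Z₉ hZ₉ = redSubι G₀ Z₀ hZ₀ ≫ γ₀ ∧ IsIso δ₀) ∧
      -- (R3) the root curve: regular, `O`-flat, off the generic point of `Y`, quasi-regular 2-frames
      Scheme.IsRegular I.subscheme ∧ Flat (I.subschemeι ≫ σ₀ ≫ q) ∧
      σ₀ '' (I.support : Set X₀) ⊆ {p : P | ¬ IsGenericPoint p Y} ∧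
      (∀ x ∈ I.support, ∃ c : Fin 2 → X₀.presheaf.stalk x, Ideal.span (Set.range c) = stalkIdeal I x ∧ IsQuasiRegular c) ∧
      -- (R4) rational root, conditional on the downstairs certificate
      (RationalCarrier (redSub F₉ Z₉ hZ₉) →
        ∃ e₁ : I.subscheme ≅ ProjCech.PP O 1, e₁.hom ≫ ProjCech.toSpec O 1 = I.subschemeι ≫ σ₀ ≫ q)

variable {O k θ P q Y}

/-- **Birth of the datum** (`ρ = 𝟙`, `ϱ = 𝟙`): right after the blowing up `τ₀ : X₁ ⟶ X₀` of a root curve `V(I)` with (R2)–(R4), the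
exceptional divisor `I·𝒪_{X₁}` carries `DirLift.Ruled` at the stage `(G₁, γ₁)` for every `γ₁` with `γ₁ ≫ υ' = υ₁ ≫ γ₀` and every `E`
(curve step: `X₀ = X₉`, `G₀ = F₉`, `γ₀ = 𝟙`, `Z₀ = Z₉`; Čech / cone round: `X₀` = the previous stage, `Z₀` = the centre's trace).
[OURS · pure logic] -/
theorem ruled_root {F₉ : Scheme.{0}} {Z₉ : Set F₉} {hZ₉ : IsClosed Z₉} {F₁₀ : Scheme.{0}} {υ' : F₁₀ ⟶ F₉}
    (X₀ : Scheme.{0}) (σ₀ : X₀ ⟶ P) (I : X₀.IdealSheafData) (X₁ : Scheme.{0}) (τ₀ : X₁ ⟶ X₀)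
    (G₀ : Scheme.{0}) (j₀ : G₀ ⟶ X₀) (t₀ : G₀ ⟶ Spec (.of k)) (γ₀ : G₀ ⟶ F₉)
    (G₁ : Scheme.{0}) (j₁ : G₁ ⟶ X₁) (t₁ : G₁ ⟶ Spec (.of k)) (υ₁ : G₁ ⟶ G₀) (γ₁ : G₁ ⟶ F₁₀) (E : Set G₁)
    [IsIntegral X₀] [IsLocallyNoetherian X₀] (hX₀ : Scheme.IsRegular X₀) (hτ₀ : IsBlowup τ₀ I)
    (hsq₀ : IsPullback j₀ t₀ (σ₀ ≫ q) (Spec.map (CommRingCat.ofHom θ)))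
    (hsq₁ : IsPullback j₁ t₁ ((τ₀ ≫ σ₀) ≫ q) (Spec.map (CommRingCat.ofHom θ)))
    (hcomm : j₁ ≫ τ₀ = υ₁ ≫ j₀) (hυ₁ : IsBlowup υ₁ (I.comap j₀)) (hγ : γ₁ ≫ υ' = υ₁ ≫ γ₀)
    (Z₀ : Set G₀) (hZ₀ : IsClosed Z₀) (hIZ₀ : I.comap j₀ = vanishingIdeal ⟨Z₀, hZ₀⟩)
    (δ₀ : redSub G₀ Z₀ hZ₀ ⟶ redSub F₉ Z₉ hZ₉) (hδ₀ : δ₀ ≫ redSubι F₉ Z₉ hZ₉ = redSubι G₀ Z₀ hZ₀ ≫ γ₀) [IsIso δ₀]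
    (hIreg : Scheme.IsRegular I.subscheme) (hIflat : Flat (I.subschemeι ≫ σ₀ ≫ q))
    (hIoff : σ₀ '' (I.support : Set X₀) ⊆ {p : P | ¬ IsGenericPoint p Y})
    (hIframe : ∀ x ∈ I.support, ∃ c : Fin 2 → X₀.presheaf.stalk x, Ideal.span (Set.range c) = stalkIdeal I x ∧ IsQuasiRegular c)
    (hIrat : RationalCarrier (redSub F₉ Z₉ hZ₉) →
      ∃ e₁ : I.subscheme ≅ ProjCech.PP O 1, e₁.hom ≫ ProjCech.toSpec O 1 = I.subschemeι ≫ σ₀ ≫ q) :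
    Ruled O k θ P q Y F₉ Z₉ hZ₉ F₁₀ υ' G₁ γ₁ E X₁ (τ₀ ≫ σ₀) j₁ (I.comap τ₀) := by
  refine ⟨X₀, σ₀, I, X₁, τ₀, 𝟙 X₁, G₀, j₀, t₀, γ₀, G₁, j₁, t₁, υ₁, 𝟙 G₁, inferInstance, inferInstance, hX₀, hτ₀,
    by simp only [Category.id_comp], ⟨Iso.refl _, by simp only [Iso.refl_hom, Category.id_comp, Category.comp_id]⟩,
    hsq₀, hsq₁, hcomm, hυ₁, by simp only [Category.id_comp, Category.comp_id], ?_, ⟨Z₀, hZ₀, hIZ₀, δ₀, hδ₀, inferInstance⟩,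
    hIreg, hIflat, hIoff, hIframe, hIrat⟩
  rw [Category.id_comp]
  exact hγ.symm

/-- **Transport of the datum along a morphism of stages** (no re-rooting): if `V(𝓔) ⊆ X` carries `DirLift.Ruled` at `(G, γ, jG)` and
`π : X' ⟶ X`, `ϖ : G' ⟶ G`, `jG' : G' ⟶ X'` satisfy `jG' ≫ π = ϖ ≫ jG`, then every `𝓔'` on `X'` with an isomorphism `V(𝓔') ≅ V(𝓔)`
OVER `π` carries it at `(G', ϖ ≫ γ, jG')`, for every `E'` — the shape of res-L1-w45b-stub-4's `hRuled` (point steps away from `E`: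
`𝓔' = 𝓔·𝒪_{X'}`) and of res-D-pv-029's `coneRound_old` / the Čech round's old surface (`𝓔' = St 𝓔`). [OURS · pure logic] -/
theorem ruled_comp {F₉ : Scheme.{0}} {Z₉ : Set F₉} {hZ₉ : IsClosed Z₉} {F₁₀ : Scheme.{0}} {υ' : F₁₀ ⟶ F₉}
    {G : Scheme.{0}} {γ : G ⟶ F₁₀} {E : Set G} {X : Scheme.{0}} {σ : X ⟶ P} {jG : G ⟶ X} {𝓔 : X.IdealSheafData}
    (h : Ruled O k θ P q Y F₉ Z₉ hZ₉ F₁₀ υ' G γ E X σ jG 𝓔)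
    {X' G' : Scheme.{0}} (π : X' ⟶ X) (ϖ : G' ⟶ G) (jG' : G' ⟶ X') (hcomm : jG' ≫ π = ϖ ≫ jG)
    (𝓔' : X'.IdealSheafData) (e' : 𝓔'.subscheme ≅ 𝓔.subscheme) (he' : e'.hom ≫ 𝓔.subschemeι = 𝓔'.subschemeι ≫ π)
    (E' : Set G') :
    Ruled O k θ P q Y F₉ Z₉ hZ₉ F₁₀ υ' G' (ϖ ≫ γ) E' X' (π ≫ σ) jG' 𝓔' := by
  obtain ⟨X₀, σ₀, I, X₁, τ₀, ρ, G₀, j₀, t₀, γ₀, G₁, j₁, t₁, υ₁, ϱ, hX₀int, hX₀noeth, hX₀reg, hτ₀, hσ, ⟨e, he⟩, hsq₀, hsq₁, hcomm₁,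
    hυ₁, hjρ, hγ, hZ, hIreg, hIflat, hIoff, hIframe, hIrat⟩ := h
  refine ⟨X₀, σ₀, I, X₁, τ₀, π ≫ ρ, G₀, j₀, t₀, γ₀, G₁, j₁, t₁, υ₁, ϖ ≫ ϱ, hX₀int, hX₀noeth, hX₀reg, hτ₀, ?_, ⟨e' ≪≫ e, ?_⟩,
    hsq₀, hsq₁, hcomm₁, hυ₁, ?_, ?_, hZ, hIreg, hIflat, hIoff, hIframe, hIrat⟩
  · rw [hσ]; simp only [Category.assoc]
  · rw [Iso.trans_hom, Category.assoc, he, ← Category.assoc, he', Category.assoc]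
  · rw [← Category.assoc, hcomm, Category.assoc, hjρ, Category.assoc]
  · simp only [Category.assoc]; rw [hγ]

/-- The stage map factors through the root: `σ = (ρ ≫ τ₀) ≫ σ₀` for the data of `DirLift.Ruled` (projection, for rewriting).
[OURS · pure logic] -/
theorem Ruled.exists_root {F₉ : Scheme.{0}} {Z₉ : Set F₉} {hZ₉ : IsClosed Z₉} {F₁₀ : Scheme.{0}} {υ' : F₁₀ ⟶ F₉}
    {G : Scheme.{0}} {γ : G ⟶ F₁₀} {E : Set G} {X : Scheme.{0}} {σ : X ⟶ P} {jG : G ⟶ X} {𝓔 : X.IdealSheafData}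
    (h : Ruled O k θ P q Y F₉ Z₉ hZ₉ F₁₀ υ' G γ E X σ jG 𝓔) :
    ∃ (X₀ : Scheme.{0}) (σ₀ : X₀ ⟶ P) (I : X₀.IdealSheafData) (X₁ : Scheme.{0}) (τ₀ : X₁ ⟶ X₀) (ρ : X ⟶ X₁),
      IsBlowup τ₀ I ∧ σ = (ρ ≫ τ₀) ≫ σ₀ ∧ Scheme.IsRegular I.subscheme ∧ Flat (I.subschemeι ≫ σ₀ ≫ q) ∧
      (∃ e : 𝓔.subscheme ≅ (I.comap τ₀).subscheme, e.hom ≫ (I.comap τ₀).subschemeι = 𝓔.subschemeι ≫ ρ) ∧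
      (RationalCarrier (redSub F₉ Z₉ hZ₉) →
        ∃ e₁ : I.subscheme ≅ ProjCech.PP O 1, e₁.hom ≫ ProjCech.toSpec O 1 = I.subschemeι ≫ σ₀ ≫ q) := by
  obtain ⟨X₀, σ₀, I, X₁, τ₀, ρ, -, -, -, -, -, -, -, -, -, -, -, -, hτ₀, hσ, he, -, -, -, -, -, -, -, hIreg, hIflat, -, -, hIrat⟩ := h
  exact ⟨X₀, σ₀, I, X₁, τ₀, ρ, hτ₀, hσ, hIreg, hIflat, he, hIrat⟩

end Summit.ResolutionOfSingularities.ResolutionOfSingularities.Cruxes.EquisingularLiftNat.Sections.DirLift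

end
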